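import Literature.Analysis.FluidPDE.TorusWeakStrongUniqueness
import Literature.Analysis.FluidPDE.LerayHopfRestartTorus
import Literature.Analysis.FluidPDE.LerayHopfDatumCongr
import Literature.Analysis.FluidPDE.TorusClassicalNSGalileanBoost
import Literature.Analysis.FluidPDE.TorusClassicalNSMaximalSolution
import Literature.Analysis.FluidPDE.PeriodicBoundedMildTorus
import Literature.Analysis.FunctionSpaces.TorusClassicalNSRestart
import HarnessLib

/-!
# Leray's «époque d'irrégularité» on `𝕋³` for Leray–Hopf weak solutions: at an époque the enstrophy
# of the classical representative is unbounded, with Leray's rate `‖∇u(t)‖₂² ≥ c ν^{3/2}/√(t₁ − t)`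

Analysis/FluidPDE proof file (theorems only; no definitions, no named facts, no `sorry`).
Leray 1934, §34 / Robinson–Rodrigo–Sadowski 2016, §8.1 p. 122 with Lemma 6.11 and Thm 6.10:
if a global Leray–Hopf weak solution `u` of the unforced Navier–Stokes equations on `𝕋³` (`ν > 0`)
agrees a.e. on `(0, t₁)` with a classical solution `(U, P)` on `(0, t₁) × 𝕋³`, and `(0, t₁)` is MAXIMAL
with this property (no classical `(U', P')` on a longer `(0, t')`, `t' > t₁`, agrees a.e. with `u`) — an
«époque d'irrégularité» in Leray's sense — then

* `Torus.not_bddAbove_gradNormSq_of_epoque` — the enstrophy `‖∇U(t)‖₂²` is unbounded on `[s, t₁)` for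
  every `s ∈ (0, t₁)`. Proof: if it were bounded, the enstrophy door
  (`Torus.classicalNS_continuation_of_gradNormSq_le_anyMean`, RRS Lemma 6.11, any mean) continues
  `U(· + s)` to a classical solution on `[0, T']`, `T' > t₁ − s`; glued with `U` along the open overlap
  `(s, t₁)` (tree `Torus.IsClassicalNSSolutionOn.glue_Ioo`) it is classical on `(0, s + T')`; the
  Leray–Hopf solution restarts at a.e. time (`IsGlobalLerayHopf.ae_isGlobalLerayHopf_translate`, RRS
  Def. 4.9 / p. 131) — pick such an `s' ∈ (s, t₁)`; its datum `u(s')` equals `U(s')` a.e.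
  (`IsGlobalLerayHopf.congr_datum_ae`), so Sather–Serrin weak–strong uniqueness
  (`Torus.IsLerayHopfOn.ae_eq_of_isClassicalNSSolutionOn`, RRS Thm 6.10) identifies `u` with the glued
  solution a.e. up to `s + T' > t₁`, contradicting maximality.
* `Torus.leray_epoque_rate` — **Leray's rate**: there is `c > 0` (the tree's constant of
  `Torus.gradNormSq_blowup_rate`, RRS Lemma 6.11) with `c ν^{3/2}/√(t₁ − t) ≤ ‖∇U(t)‖₂²` for every
  `t ∈ (0, t₁)`, for data of ANY mean (Galilean reduction `Torus.isClassicalNSSolutionOn_galileanBoost`: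
  the mean is conserved, the boost has mean-zero slices and the same enstrophy).
* `Torus.lerayHopf_classical_or_epoque` / `Torus.lerayHopf_classical_or_epoque_rate` — Leray's structure for
  SMOOTH data: every global Leray–Hopf solution from a smooth divergence-free datum is a.e. classical for
  all `t > 0`, or a.e. classical exactly up to a first époque `t₁`, where the enstrophy blows up with the rate.
Consumer: cell `ns-claims`, row C129 `Literature.Claims.NS.Nadirashvili2026.Step_LerayRate` (Thm 5.6 p.34,
«Let 0 < t₁ < ∞ be an "époque de irrégularite" for w. Then ‖∇w‖ ≥ Cν^{3/4}/(t₁−t)^{1/4}») — TRUE,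
discharged in `Theorems/SoloSalvageNadirashvili2026LerayRate.lean` from `Torus.leray_epoque_rate`.

## References

* J. Leray, *Sur le mouvement d'un liquide visqueux emplissant l'espace*, Acta Math. 63 (1934), §34
  (époques d'irrégularité; the rate `(T − t)^{−1/4}` for `‖∇u‖`). [`Leray1934`]
* J. C. Robinson, J. L. Rodrigo, W. Sadowski, *The Three-Dimensional Navier–Stokes Equations*, CUP 2016,
  Lemma 6.11, Thm 6.10, Def. 4.9, §8.1 p. 122. [`RobinsonRodrigoSadowskiCUP2016`]

WHAT THIS IS NOT: not a claim about NS regularity or blow-up; not a claim about any author beyond the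
typed locator.
-/

open MeasureTheory Set Filter Topology UnitAddTorus Function
open scoped ENNReal NNReal InnerProductSpace

noncomputable section

namespace Literature.Analysis.FluidPDE

open FunctionSpaces


/-! ## §1 At an époque the enstrophy of the classical representative is unbounded -/

/-- **Époque ⇒ enstrophy blow-up** (Leray 1934 §34; RRS 2016 §8.1 p. 122 with Lemma 6.11 / Thm 6.10).
Let `ν > 0`, `u` a global Leray–Hopf weak solution of the unforced equations on `𝕋ᵈ`,
`(U, P)` classical on `(0, t₁)` with `U(t) = u(t)` a.e. for `t ∈ (0, t₁)`, and `(0, t₁)` maximal with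
this property. Then for every `s ∈ (0, t₁)` the enstrophy `‖∇U(t)‖₂²` is unbounded on `[s, t₁)`.
[cite: RobinsonRodrigoSadowskiCUP2016, §8.1 p. 122 (with Lemma 6.11, Thm 6.10, Def. 4.9)] -/
theorem Torus.not_bddAbove_gradNormSq_of_epoque {ν t₁ : ℝ} (hν : 0 < ν)
    {u₀ : UnitAddTorus (Fin 3) → EuclideanSpace ℝ (Fin 3)} {u U : ℝ → UnitAddTorus (Fin 3) → EuclideanSpace ℝ (Fin 3)}
    {P : ℝ → UnitAddTorus (Fin 3) → ℝ} (hu : Torus.IsGlobalLerayHopf ν 0 u₀ u)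
    (hU : Torus.IsClassicalNSSolutionOn (Ioo 0 t₁) ν 0 U P)
    (hagree : ∀ t ∈ Ioo 0 t₁, U t =ᵐ[volume] u t)
    (hmax : ∀ t', t₁ < t' → ¬ ∃ (U' : ℝ → UnitAddTorus (Fin 3) → EuclideanSpace ℝ (Fin 3))
      (P' : ℝ → UnitAddTorus (Fin 3) → ℝ), Torus.IsClassicalNSSolutionOn (Ioo 0 t') ν 0 U' P' ∧
        ∀ t ∈ Ioo 0 t', U' t =ᵐ[volume] u t)
    {s : ℝ} (hs : s ∈ Ioo 0 t₁) :
    ¬ BddAbove ((fun t => Torus.gradNormSq (U t)) '' Ico s t₁) := by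
  rintro ⟨E₁, hE₁⟩
  have hs0 : 0 < s := hs.1
  have hst : s < t₁ := hs.2
  -- the shifted classical solution `r ↦ U (r + s)` on `[0, t₁ − s)`, with bounded enstrophy
  have hV : Torus.IsClassicalNSSolutionOn (Ico 0 (t₁ - s)) ν 0 (fun r => U (r + s)) (fun r => P (r + s)) := by
    have h := hU.comp_add_const s
    refine h.mono (fun r hr => ?_) (uniqueDiffOn_Ico 0 (t₁ - s))
    exact ⟨by linarith [hr.1], by linarith [hr.2]⟩
  have hVE : ∀ r ∈ Ico 0 (t₁ - s), Torus.gradNormSq (U (r + s)) ≤ E₁ := fun r hr =>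
    hE₁ ⟨r + s, ⟨by linarith [hr.1], by linarith [hr.2]⟩, rfl⟩
  obtain ⟨T', hT', u', p', hu', hagree'⟩ :=
    Torus.classicalNS_continuation_of_gradNormSq_le_anyMean (d := Fin 3) (by simp) hν (sub_pos.2 hst) hV hVE
  -- shift back: `W τ = u' (τ − s)` on `(s, s + T')`
  have hW : Torus.IsClassicalNSSolutionOn (Ioo s (s + T')) ν 0 (fun τ => u' (τ + -s)) (fun τ => p' (τ + -s)) := by
    have h := hu'.comp_add_const (-s)
    refine h.mono (fun τ hτ => ?_) (uniqueDiffOn_Ioo s (s + T'))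
    exact ⟨by linarith [hτ.1], by linarith [hτ.2]⟩
  have hb : t₁ < s + T' := by linarith
  -- glue `U` on `(0, t₁)` with `W` on `(s, s + T')` along `(s, t₁)`
  have hov : ∀ t ∈ Ioo s t₁, U t = u' (t + -s) := by
    intro t ht
    have h := hagree' (t + -s) ⟨by linarith [ht.1], by linarith [ht.2]⟩
    rw [h]
    congr 1
    ring
  have hG := hU.glue_Ioo hW hs0.le hst hb.le hov (0 : UnitAddTorus (Fin 3))
  -- a restart time `s' ∈ (s, t₁)` of the Leray–Hopf solution
  have hzero : (0 : ℝ → UnitAddTorus (Fin 3) → EuclideanSpace ℝ (Fin 3)) =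
      fun _ => (0 : UnitAddTorus (Fin 3) → EuclideanSpace ℝ (Fin 3)) := rfl
  have hae : ∀ᵐ s' ∂volume, 0 < s' →
      Torus.IsGlobalLerayHopf ν (fun _ => (0 : UnitAddTorus (Fin 3) → EuclideanSpace ℝ (Fin 3))) (u s')
        (fun t => u (t + s')) := by
    have hu' : Torus.IsGlobalLerayHopf ν (fun _ => (0 : UnitAddTorus (Fin 3) → EuclideanSpace ℝ (Fin 3))) u₀ u := by
      rw [← hzero]; exact hu
    exact hu'.ae_isGlobalLerayHopf_translate (Torus.isSmooth_const _) hν.le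
  have hae' : ∀ᵐ s' ∂(volume.restrict (Ioo s t₁)), s' ∈ Ioo s t₁ ∧
      Torus.IsGlobalLerayHopf ν (fun _ => (0 : UnitAddTorus (Fin 3) → EuclideanSpace ℝ (Fin 3))) (u s')
        (fun t => u (t + s')) := by
    filter_upwards [ae_restrict_mem measurableSet_Ioo, ae_restrict_of_ae hae] with s' hs' h
    exact ⟨hs', h (hs0.trans hs'.1)⟩
  haveI : (ae (volume.restrict (Ioo s t₁))).NeBot := by
    rw [ae_neBot, Ne, Measure.restrict_eq_zero, Real.volume_Ioo]
    exact (ENNReal.ofReal_pos.2 (sub_pos.2 hst)).ne'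
  obtain ⟨s', hs', hLH⟩ := hae'.exists
  rw [← hzero] at hLH
  -- the restarted solution starts from `G s' = U s'` a.e.
  set G : ℝ → UnitAddTorus (Fin 3) → EuclideanSpace ℝ (Fin 3) := fun t => if t < t₁ then U t else u' (t + -s) with hGdef
  have hGs' : G s' = U s' := by simp only [hGdef, if_pos hs'.2]
  have hLHG : Torus.IsGlobalLerayHopf ν 0 ((fun r => G (r + s')) 0) (fun t => u (t + s')) := by
    have h1 : G s' =ᵐ[volume] u s' := by rw [hGs']; exact hagree s' ⟨hs0.trans hs'.1, hs'.2⟩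
    have h2 := hLH.congr_datum_ae h1
    simpa only [zero_add] using h2
  -- the glued solution, restarted at `s'`, is classical on `[0, s + T' − s')`
  have hR : Torus.IsClassicalNSSolutionOn (Ico 0 (s + T' - s')) ν 0 (fun r => G (r + s'))
      (fun r => (fun t => if t < t₁ then (fun x => P t x - P t 0) else fun x => p' (t + -s) x - p' (t + -s) 0)
        (r + s')) := by
    have h := hG.comp_add_const s'
    refine h.mono (fun r hr => ?_) (uniqueDiffOn_Ico 0 _)
    exact ⟨by linarith [hr.1, hs'.1], by linarith [hr.2]⟩
  -- hence `u` agrees a.e. with `G` on `(0, s + T')`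
  have hGu : ∀ t ∈ Ioo 0 (s + T'), G t =ᵐ[volume] u t := by
    intro t ht
    by_cases htt : t < t₁
    · have : G t = U t := by simp only [hGdef, if_pos htt]
      rw [this]; exact hagree t ⟨ht.1, htt⟩
    · have hTpos : 0 < t - s' := by linarith [not_lt.1 htt, hs'.2]
      have hsub : Icc 0 (t - s') ⊆ Ico 0 (s + T' - s') := fun r hr => ⟨hr.1, by linarith [hr.2, ht.2]⟩
      have h := (hLHG (t - s') hTpos).ae_eq_of_isClassicalNSSolutionOn hR (convex_Ico 0 _) hsub hν.le
        hTpos (t - s') ⟨hTpos, le_rfl⟩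
      have ht' : t - s' + s' = t := by ring
      simp only [ht'] at h
      exact h.symm
  exact hmax (s + T') hb ⟨G, _, hG, hGu⟩

/-! ## §2 Leray's rate at an époque, any mean -/

/-- **Leray's rate at an époque d'irrégularité** (Leray 1934 §34; RRS 2016 Lemma 6.11: «if u … blows
up at time T* then ‖∇u(t)‖² ≥ c′/√(T* − t)»): there is `c > 0` such that, for `ν > 0`,
every global Leray–Hopf weak solution `u` of the unforced equations on `𝕋ᵈ` whose classical
representative `(U, P)` on a MAXIMAL window `(0, t₁)` exists satisfies
`c ν^{3/2}/√(t₁ − t) ≤ ‖∇U(t)‖₂²` for all `t ∈ (0, t₁)` — data of any mean (the mean is conserved and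
removed by a Galilean boost, which preserves the enstrophy).
[cite: RobinsonRodrigoSadowskiCUP2016, Lemma 6.11 with §8.1 p. 122 and §1.8] -/
theorem Torus.leray_epoque_rate :
    ∃ c : ℝ, 0 < c ∧ ∀ {ν t₁ : ℝ}, 0 < ν →
      ∀ {u₀ : UnitAddTorus (Fin 3) → EuclideanSpace ℝ (Fin 3)} {u U : ℝ → UnitAddTorus (Fin 3) → EuclideanSpace ℝ (Fin 3)}
        {P : ℝ → UnitAddTorus (Fin 3) → ℝ}, Torus.IsGlobalLerayHopf ν 0 u₀ u →
        Torus.IsClassicalNSSolutionOn (Ioo 0 t₁) ν 0 U P →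
        (∀ t ∈ Ioo 0 t₁, U t =ᵐ[volume] u t) →
        (∀ t', t₁ < t' → ¬ ∃ (U' : ℝ → UnitAddTorus (Fin 3) → EuclideanSpace ℝ (Fin 3))
          (P' : ℝ → UnitAddTorus (Fin 3) → ℝ), Torus.IsClassicalNSSolutionOn (Ioo 0 t') ν 0 U' P' ∧
            ∀ t ∈ Ioo 0 t', U' t =ᵐ[volume] u t) →
        ∀ t ∈ Ioo 0 t₁, c * ν ^ (3 / 2 : ℝ) / Real.sqrt (t₁ - t) ≤ Torus.gradNormSq (U t) := by
  obtain ⟨c, hc, H⟩ := Torus.gradNormSq_blowup_rate (d := Fin 3) (by simp)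
  refine ⟨c, hc, fun {ν t₁} hν {u₀ u U P} hu hU hagree hmax t ht => ?_⟩
  -- the classical representative on `[t, t₁)`, boosted to mean zero
  have hUt : Torus.IsClassicalNSSolutionOn (Ico t t₁) ν 0 U P :=
    hU.mono (fun τ hτ => ⟨ht.1.trans_le hτ.1, hτ.2⟩) (uniqueDiffOn_Ico t t₁)
  set m : EuclideanSpace ℝ (Fin 3) := ∫ y, U t y with hm
  have hmean : ∀ τ ∈ Ico t t₁, ∫ y, U τ y = m := fun τ hτ =>
    hUt.integral_velocity_eq (convex_Ico t t₁) (fun _ _ => by simp) ⟨le_rfl, ht.2⟩ hτ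
  have hB := Torus.isClassicalNSSolutionOn_galileanBoost (uniqueDiffOn_Ico t t₁) hUt m
  have hBmean : ∀ τ ∈ Ico t t₁, Torus.HasZeroMean (fun x => U τ (x + Torus.proj (τ • m)) - m) := by
    intro τ hτ
    unfold Torus.HasZeroMean
    rw [Torus.integral_comp_add_right_sub_const (hUt.smooth_velocity.isSmooth_slice hτ).integrable,
      hmean τ hτ, sub_self]
  have hBunb : ¬ BddAbove ((fun τ => Torus.gradNormSq (fun x => U τ (x + Torus.proj (τ • m)) - m)) '' Ico t t₁) := by
    have hfun : (fun τ => Torus.gradNormSq (fun x => U τ (x + Torus.proj (τ • m)) - m)) =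
        fun τ => Torus.gradNormSq (U τ) := by
      funext τ; exact Torus.gradNormSq_comp_add_right_sub_const (U τ) _ m
    rw [hfun]
    exact Torus.not_bddAbove_gradNormSq_of_epoque hν hu hU hagree hmax ht
  have h := H hν hB hBmean hBunb t ⟨le_rfl, ht.2⟩
  rwa [Torus.gradNormSq_comp_add_right_sub_const] at h

/-! ## §3 Leray's structure for smooth data: classical until the first époque -/

/-- **Classical until the first époque** (Leray 1934 §34; RRS 2016 §8.1 p. 122 with Thm 6.10): for
`ν > 0` and a SMOOTH divergence-free datum `u₀` on `𝕋³` (any mean), every global Leray–Hopf weak solution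
`u` from `u₀` EITHER agrees a.e. on every slice `t > 0` with a global classical solution from `u₀`, OR there
is `0 < t₁ < ∞` and a classical solution `(U, P)` on `[0, t₁)` from `u₀` with `u(t) = U(t)` a.e. for
`t ∈ (0, t₁)`, enstrophy unbounded on `[0, t₁)`, and `(0, t₁)` MAXIMAL: no classical solution on a longer
`(0, t')`, `t' > t₁`, agrees a.e. with `u` — i.e. `t₁` is an «époque d'irrégularité» of `u` in the sense of
`Torus.not_bddAbove_gradNormSq_of_epoque` / `Torus.leray_epoque_rate`, to which the rate applies. Proof:
the maximal classical solution (`Torus.exists_maximal_classicalNS_anyMean`) plus Sather–Serrin weak–strong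
uniqueness; a longer classical representative would coincide with `U` on `(0, t₁)` (continuity) and have
continuous, hence bounded, enstrophy across `t₁`. [cite: RobinsonRodrigoSadowskiCUP2016, §8.1 p. 122 (with Thm 6.10, Lemma 6.11)] -/
theorem Torus.lerayHopf_classical_or_epoque {ν : ℝ} (hν : 0 < ν)
    {u₀ : UnitAddTorus (Fin 3) → EuclideanSpace ℝ (Fin 3)} (hs : Torus.IsSmooth u₀) (hd : Torus.IsDivFree u₀)
    {u : ℝ → UnitAddTorus (Fin 3) → EuclideanSpace ℝ (Fin 3)} (hu : Torus.IsGlobalLerayHopf ν 0 u₀ u) :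
    (∃ (U : ℝ → UnitAddTorus (Fin 3) → EuclideanSpace ℝ (Fin 3)) (P : ℝ → UnitAddTorus (Fin 3) → ℝ),
        Torus.IsClassicalNSSolutionOn (Ici 0) ν 0 U P ∧ U 0 = u₀ ∧ ∀ t : ℝ, 0 < t → U t =ᵐ[volume] u t) ∨
      ∃ (t₁ : ℝ) (U : ℝ → UnitAddTorus (Fin 3) → EuclideanSpace ℝ (Fin 3)) (P : ℝ → UnitAddTorus (Fin 3) → ℝ),
        0 < t₁ ∧ Torus.IsClassicalNSSolutionOn (Ico 0 t₁) ν 0 U P ∧ U 0 = u₀ ∧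
        (∀ t ∈ Ioo 0 t₁, U t =ᵐ[volume] u t) ∧
        ¬ BddAbove ((fun t => Torus.gradNormSq (U t)) '' Ico 0 t₁) ∧
        ∀ t', t₁ < t' → ¬ ∃ (U' : ℝ → UnitAddTorus (Fin 3) → EuclideanSpace ℝ (Fin 3))
          (P' : ℝ → UnitAddTorus (Fin 3) → ℝ), Torus.IsClassicalNSSolutionOn (Ioo 0 t') ν 0 U' P' ∧
            ∀ t ∈ Ioo 0 t', U' t =ᵐ[volume] u t := by
  obtain ⟨U, P, hU0, hcases⟩ :=
    Torus.exists_maximal_classicalNS_anyMean (d := Fin 3) (by simp) hν hs hd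
  have hu' : Torus.IsGlobalLerayHopf ν 0 (U 0) u := by rw [hU0]; exact hu
  rcases hcases with ⟨hglob, -⟩ | ⟨T, hT, hsol, hunb, -⟩
  · refine Or.inl ⟨U, P, hglob, hU0, fun t ht => ?_⟩
    exact (hu'.ae_eq_of_isClassicalNSSolutionOn_Ici hglob hν.le t ht).symm
  · -- agreement on `(0, T)` by weak–strong uniqueness on every `[0, t]`, `t < T`
    have hagree : ∀ t ∈ Ioo 0 T, U t =ᵐ[volume] u t := by
      intro t ht
      exact ((hu' t ht.1).ae_eq_of_isClassicalNSSolutionOn hsol (convex_Ico 0 T)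
        (Icc_subset_Ico_right ht.2) hν.le ht.1 t ⟨ht.1, le_rfl⟩).symm
    refine Or.inr ⟨T, U, P, hT, hsol, hU0, hagree, hunb, fun t' ht' hex => ?_⟩
    obtain ⟨U', P', hU', hagree'⟩ := hex
    -- `U' = U` on `(0, T)` (both continuous representatives of `u(t)`)
    have heq : ∀ t ∈ Ioo 0 T, U' t = U t := by
      intro t ht
      have hae : U' t =ᵐ[volume] U t := (hagree' t ⟨ht.1, ht.2.trans ht'⟩).trans (hagree t ht).symm
      exact (Continuous.ae_eq_iff_eq volume
        (hU'.smooth_velocity.isSmooth_slice (show t ∈ Ioo 0 t' from ⟨ht.1, ht.2.trans ht'⟩)).continuous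
        (hsol.smooth_velocity.isSmooth_slice (show t ∈ Ico 0 T from ⟨ht.1.le, ht.2⟩)).continuous).1 hae
    -- enstrophy of `U` is bounded on `[0, T/2]` and of `U'` on `[T/2, (T + t')/2]`: contradiction
    have hT2 : 0 < T / 2 := half_pos hT
    have hT2' : T / 2 < T := half_lt_self hT
    have hm : T < (T + t') / 2 := by linarith
    have hm' : (T + t') / 2 < t' := by linarith
    have h1 : Torus.IsClassicalNSSolutionOn (Icc 0 (T / 2)) ν 0 U P :=
      hsol.mono (Icc_subset_Ico_right hT2') (uniqueDiffOn_Icc hT2)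
    have h2 : Torus.IsClassicalNSSolutionOn (Icc (T / 2) ((T + t') / 2)) ν 0 U' P' :=
      hU'.mono (fun s hs' => ⟨hT2.trans_le hs'.1, lt_of_le_of_lt hs'.2 hm'⟩) (uniqueDiffOn_Icc (hT2'.trans hm))
    have hc1 := h1.smooth_velocity.continuousOn_gradNormSq (convex_Icc 0 (T / 2)) (uniqueDiffOn_Icc hT2)
    have hc2 := h2.smooth_velocity.continuousOn_gradNormSq (convex_Icc _ _) (uniqueDiffOn_Icc (hT2'.trans hm))
    obtain ⟨B₁, hB₁⟩ := isCompact_Icc.bddAbove_image hc1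
    obtain ⟨B₂, hB₂⟩ := isCompact_Icc.bddAbove_image hc2
    refine hunb ⟨max B₁ B₂, ?_⟩
    rintro _ ⟨t, ht, rfl⟩
    rcases le_or_gt t (T / 2) with hle | hlt
    · exact le_max_of_le_left (hB₁ ⟨t, ⟨ht.1, hle⟩, rfl⟩)
    · have htI : t ∈ Ioo 0 T := ⟨hT2.trans hlt, ht.2⟩
      have h := hB₂ ⟨t, ⟨hlt.le, by linarith [ht.2]⟩, rfl⟩
      simp only at h
      rw [heq t htI] at h
      exact le_max_of_le_right h

/-- **Leray's rate at the first époque of a Leray–Hopf solution from smooth data** (the two previous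
theorems combined): in the second case of `Torus.lerayHopf_classical_or_epoque`,
`c ν^{3/2}/√(t₁ − t) ≤ ‖∇U(t)‖₂²` on `(0, t₁)` with the absolute constant of `Torus.leray_epoque_rate`.
[cite: RobinsonRodrigoSadowskiCUP2016, Lemma 6.11 with §8.1 p. 122] -/
theorem Torus.lerayHopf_classical_or_epoque_rate :
    ∃ c : ℝ, 0 < c ∧ ∀ {ν : ℝ}, 0 < ν →
      ∀ {u₀ : UnitAddTorus (Fin 3) → EuclideanSpace ℝ (Fin 3)}, Torus.IsSmooth u₀ → Torus.IsDivFree u₀ →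
      ∀ {u : ℝ → UnitAddTorus (Fin 3) → EuclideanSpace ℝ (Fin 3)}, Torus.IsGlobalLerayHopf ν 0 u₀ u →
        (∃ (U : ℝ → UnitAddTorus (Fin 3) → EuclideanSpace ℝ (Fin 3)) (P : ℝ → UnitAddTorus (Fin 3) → ℝ),
            Torus.IsClassicalNSSolutionOn (Ici 0) ν 0 U P ∧ U 0 = u₀ ∧ ∀ t : ℝ, 0 < t → U t =ᵐ[volume] u t) ∨
          ∃ (t₁ : ℝ) (U : ℝ → UnitAddTorus (Fin 3) → EuclideanSpace ℝ (Fin 3)) (P : ℝ → UnitAddTorus (Fin 3) → ℝ),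
            0 < t₁ ∧ Torus.IsClassicalNSSolutionOn (Ico 0 t₁) ν 0 U P ∧ U 0 = u₀ ∧
            (∀ t ∈ Ioo 0 t₁, U t =ᵐ[volume] u t) ∧
            ∀ t ∈ Ioo 0 t₁, c * ν ^ (3 / 2 : ℝ) / Real.sqrt (t₁ - t) ≤ Torus.gradNormSq (U t) := by
  obtain ⟨c, hc, H⟩ := Torus.leray_epoque_rate
  refine ⟨c, hc, fun {ν} hν {u₀} hs hd {u} hu => ?_⟩
  rcases Torus.lerayHopf_classical_or_epoque hν hs hd hu with h | ⟨t₁, U, P, ht₁, hsol, hU0, hagree, -, hmax⟩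
  · exact Or.inl h
  · refine Or.inr ⟨t₁, U, P, ht₁, hsol, hU0, hagree, ?_⟩
    exact H hν hu (hsol.mono Ioo_subset_Ico_self (uniqueDiffOn_Ioo 0 t₁)) hagree hmax

end Literature.Analysis.FluidPDE

end
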